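import Mathlib
import Summits.NavierStokesRegularity.NavierStokesRegularity.Theorems.TaoLadderRungTwoFlatCoMovingEnergyCalculus
import HarnessLib

/-!
# Tao ladder, rung 2♭ — the EDGE INPUT of the co-moving energy inequality in terms of amplitudes (junk race L8b-1,
  supplement) (helper for stmt-NavierStokesRegularity-23909 `GradedAdiabaticWake` / stmt-…-23908, children of K_A♭
  stmt-…-22987; route TaoLadderRungTwoFlat; cell harvest/h2-tao-ladder, p1 g21; LADDER §49.3 E1/E2, §49.5)

`…CoMovingEnergyRate.weightedSource_le` / `…CoMovingEnergyDecay.coMovingEnergyOn_decay_Icc` carry the edge input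
`E = φ_a|T_{a−1}(u)| + φ_P|T_P(u)| + (1+ε)c̄M(φ_a q_{a−1}² + φ_P p_{P+1}²)` of a block `[a,P]`. This file bounds it by
amplitudes: with `|u| ≤ A` at the four boundary values, the CORE deviation `|p_{P+1}| ≤ r` (`r ≤ A`) just above the
edge, clocks `≤ c̄`, template bound `M ≥ 0` and the top weight `φ_P ≤ 1` (`P ≤ n_e`),
  `E ≤ φ_a·(1+ε)c̄·A²(A + M) + (1+ε)c̄·r·(A² + M·r)`:
the bottom input carries the weight `φ_a = e^{−θ(n_e − a)}` (→ 0 down the block), the top input is FIRST ORDER in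
the core deviation `r` — the `core → behind` entry of theory-1's two-zone loop (JUNK-RACE-49 §49.5, with E3 =
`coMovingEnergyOn_Icc_succ_le`).

HONEST FRAMING: an elementary inequality about a MODEL lattice (Tao 2016 §4 vocabulary on `S♭`); nothing certified;
nothing about the Navier–Stokes equations.
-/

noncomputable section

-- the sub-problem namespace repeats the summit name by design (D-0017)
set_option linter.dupNamespace false

namespace Summit.NavierStokesRegularity.NavierStokesRegularity.Theorems

open Literature.Analysis.FluidPDE Literature.Analysis.FluidPDE.TaoCascade

namespace MirrorPulse

/-- **EDGE INPUT BY AMPLITUDES.** See the module docstring.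
[cite: Tao2016AveragedNS, §4 (4.3); route TaoLadderRungTwoFlat, L8b-1/L8b-4 (LADDER §49.3, §49.5)] -/
theorem edgeInput_le {ε ε₀ θ ne A M cbar r : ℝ} (hε : 0 ≤ ε) (hε₀ : -1 ≤ ε₀) (hθ : 0 ≤ θ) (hM : 0 ≤ M)
    {a P : ℤ} (u : Fin 2 → ℤ → ℝ → ℝ) (t : ℝ) (hPne : (P : ℝ) ≤ ne)
    (hqa : |u 1 (a - 1) t| ≤ A) (hpa : |u 0 a t| ≤ A) (hqP : |u 1 P t| ≤ A) (hr : |u 0 (P + 1) t| ≤ r)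
    (hrA : r ≤ A) (hca : clock ε₀ (a - 1) ≤ cbar) (hcP : clock ε₀ P ≤ cbar) :
    Real.exp (θ * ((a : ℝ) - ne)) * |fluxT ε ε₀ u (a - 1) t| + Real.exp (θ * ((P : ℝ) - ne)) * |fluxT ε ε₀ u P t|
        + (1 + ε) * cbar * M * (Real.exp (θ * ((a : ℝ) - ne)) * u 1 (a - 1) t ^ 2
            + Real.exp (θ * ((P : ℝ) - ne)) * u 0 (P + 1) t ^ 2)
      ≤ Real.exp (θ * ((a : ℝ) - ne)) * ((1 + ε) * cbar * A ^ 2 * (A + M))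
        + (1 + ε) * cbar * r * (A ^ 2 + M * r) := by
  set φa := Real.exp (θ * ((a : ℝ) - ne)) with hφa
  set φP := Real.exp (θ * ((P : ℝ) - ne)) with hφP
  have hφa0 : 0 ≤ φa := (Real.exp_pos _).le
  have hφP0 : 0 ≤ φP := (Real.exp_pos _).le
  have hφP1 : φP ≤ 1 := by
    rw [hφP, Real.exp_le_one_iff]; exact mul_nonpos_of_nonneg_of_nonpos hθ (by linarith)
  have hA0 : 0 ≤ A := (abs_nonneg _).trans hqa
  have hr0 : 0 ≤ r := (abs_nonneg _).trans hr
  have hca0 : 0 ≤ clock ε₀ (a - 1) := clock_nonneg hε₀ _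
  have hcP0 : 0 ≤ clock ε₀ P := clock_nonneg hε₀ _
  have hcbar : 0 ≤ cbar := hcP0.trans hcP
  -- bottom bond: |T_{a-1}| ≤ c_{a-1}(1+ε)A·|q_{a-1}||p_a| ≤ c̄(1+ε)A³
  have hpa' : |u 0 (a - 1 + 1) t| ≤ A := by rw [sub_add_cancel]; exact hpa
  have hTa := abs_fluxT_le hε hε₀ u (a - 1) t hqa hpa'
  have hTa' : |fluxT ε ε₀ u (a - 1) t| ≤ cbar * ((1 + ε) * A) * (A * A) := by
    refine hTa.trans ?_
    have h1 : |u 1 (a - 1) t| * |u 0 (a - 1 + 1) t| ≤ A * A :=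
      mul_le_mul hqa hpa' (abs_nonneg _) hA0
    have h2 : 0 ≤ (1 + ε) * A := by positivity
    calc clock ε₀ (a - 1) * ((1 + ε) * A) * (|u 1 (a - 1) t| * |u 0 (a - 1 + 1) t|)
        ≤ clock ε₀ (a - 1) * ((1 + ε) * A) * (A * A) :=
          mul_le_mul_of_nonneg_left h1 (mul_nonneg hca0 h2)
      _ ≤ cbar * ((1 + ε) * A) * (A * A) := by gcongr
  -- top bond: |T_P| ≤ c_P(1+ε)A·|q_P||p_{P+1}| ≤ c̄(1+ε)A·A·r
  have hTP := abs_fluxT_le hε hε₀ u P t hqP (hr.trans hrA)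
  have hTP' : |fluxT ε ε₀ u P t| ≤ cbar * ((1 + ε) * A) * (A * r) := by
    refine hTP.trans ?_
    have h1 : |u 1 P t| * |u 0 (P + 1) t| ≤ A * r := mul_le_mul hqP hr (abs_nonneg _) hA0
    have h2 : 0 ≤ (1 + ε) * A := by positivity
    calc clock ε₀ P * ((1 + ε) * A) * (|u 1 P t| * |u 0 (P + 1) t|)
        ≤ clock ε₀ P * ((1 + ε) * A) * (A * r) := mul_le_mul_of_nonneg_left h1 (mul_nonneg hcP0 h2)
      _ ≤ cbar * ((1 + ε) * A) * (A * r) := by gcongr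
  -- squares
  have hq2 : u 1 (a - 1) t ^ 2 ≤ A ^ 2 := by
    rw [← sq_abs]; exact pow_le_pow_left₀ (abs_nonneg _) hqa 2
  have hp2 : u 0 (P + 1) t ^ 2 ≤ r ^ 2 := by
    rw [← sq_abs]; exact pow_le_pow_left₀ (abs_nonneg _) hr 2
  -- assemble
  have hK : 0 ≤ (1 + ε) * cbar * M := by positivity
  have e1 : φa * |fluxT ε ε₀ u (a - 1) t| ≤ φa * (cbar * ((1 + ε) * A) * (A * A)) :=
    mul_le_mul_of_nonneg_left hTa' hφa0
  have e2 : φP * |fluxT ε ε₀ u P t| ≤ 1 * (cbar * ((1 + ε) * A) * (A * r)) :=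
    mul_le_mul hφP1 hTP' (abs_nonneg _) zero_le_one
  have e3 : (1 + ε) * cbar * M * (φa * u 1 (a - 1) t ^ 2 + φP * u 0 (P + 1) t ^ 2)
      ≤ (1 + ε) * cbar * M * (φa * A ^ 2 + 1 * r ^ 2) := by
    refine mul_le_mul_of_nonneg_left (add_le_add ?_ ?_) hK
    · exact mul_le_mul_of_nonneg_left hq2 hφa0
    · exact mul_le_mul hφP1 hp2 (sq_nonneg _) zero_le_one
  have hsum := add_le_add (add_le_add e1 e2) e3
  refine hsum.trans (le_of_eq ?_)
  ring

end MirrorPulse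

end Summit.NavierStokesRegularity.NavierStokesRegularity.Theorems

end
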